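import Summits.BirchSwinnertonDyer.BirchSwinnertonDyer.Theorems.ByReductionTypeAtTwoAdditivePotMultConjATwoNarrowRoadKitSquares
import HarnessLib

/-!
# C4″ `AdditivePotMultOverKAtTwo` (item stmt-BirchSwinnertonDyer-22618), the (I1M′) input on the `0 < Δ` rows:
# the NARROW-ROAD KIT, part B (DOORS) — parity of `h(A)` from the one-bit currency, the residue non-square criterion, the two
# `#(U⁺/U²) = 2` assemblies and the final cubic-model door of k4-w1's zero-hypothesis narrow-Fukuda road (`conjA_two_445508b1''`)

Cell `bsd-2adic`, rung K4, seat `bsd-2adic-k4-w3` GEN 12 (explicit unit of director-bsd g16 (309)(7); `--supports stmt-BirchSwinnertonDyer-22618`).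
HONEST FRAMING (D-0036/D-0054/D-0152): THEOREMS ONLY (no definition, no named fact, no `sorry`, no instance). Generic plumbing; closes
nothing at the `∀`-level (C4″ / (I1M′) stay research-open); nothing booked; BSD is not proved by any of this.

THE ROAD (k4-w1 GEN 10, row `445508b1`; cruxlead-19573-w2 GEN 9 NARROW FUKUDA). For a census cubic model `y² = x³ + px² + qx + r`
with irreducible cubic and TOTALLY REAL `2`-torsion field `E = ℚ(β) = ℚ(θ)` (`θ` a root of a reduced generator of the same field):
Fukuda index `0` for every cyclotomic `ℤ₂`-extension of `E` and ONE equality of narrow `2`-ranks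
`[Cl⁺(A) : Cl⁺(A)²] = [Cl⁺(E) : Cl⁺(E)²]`, `A = E ⊔ ℚ_1 = E(√2)`, give Coates–Sujatha's statement (A) at `(W, 2)`
(`conjA_two_of_pointField_of_narrowRank_sqrtTwo_model`). Both indices are computed as `#(U⁺/U²)` once `h` is odd
(`index_range_pow_two_narrowClassGroup_eq_card_totPosUnitsModSq_of_odd_classNumber`). This file makes every step that does not
depend on the particular cubic a theorem with the cubic `⟨1, p, q, r⟩` as a parameter:

Part A (`…NarrowRoadKit`): §0 helpers, §1 layer basics/embeddings. Part B (`…NarrowRoadKitSquares`): §2 non-square transfer, §3 parity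
of `h(A)`, §4 residue criterion. This part:

* §6 `signVec_eq_one_of_scaled_neg` / `signVec_eq_zero_of_scaled_pos` / `embedding_pos_of_scaled_pos` (sign bits of a unit `e` from a
  scaled value `d·e = v`), `card_totPosUnitsModSq_eq_two_of_cubic_certificate` (`#(U⁺/U²)(E) = 2` from `−1`, one mixed-sign unit and a
  non-square totally positive unit), `card_totPosUnitsModSq_sup_layer_one_of_signMatrix` (`#(U⁺/U²)(A) = 2` from an invertible `5 × 5` sign
  matrix and the same `E`-unit), `narrowIndex_sup_layer_one_eq_of_cards` (the hypothesis `hr` of the narrow-Fukuda door from the two cards,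
  `h(E)` odd and the one-bit currency).
* §5 **`conjA_two_cubicModel_of_narrowRoad`** — the door in census currency: (A)₂ for `y² = x³ + Px² + Qx + R` from
  `ℚ(β) = ℚ(θ)`, `E = ℚ(θ)` totally real, Fukuda index `0`, and the index equality.

References: [Fukuda1994] Thm. 1 (2), p. 264; [CoatesSujatha2005] Conj. A, Thm. 3.4; [FrohlichTaylor1990] Ch. V §1 (1.8)–(1.13);
[Washington1997] §13.1, Prop. 13.2; [Lang1990] Ch. 13 §4 Lemma 4.1; [Cohen1993] §4.1.3; [Marcus1977] Ch. 5 Thm. 22.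
-/

set_option autoImplicit false
-- sibling precedent (`…NarrowRankStamp445508b1.lean`): the directory name repeats the summit name
set_option linter.dupNamespace false

noncomputable section

open scoped Classical IntermediateField NumberField

namespace Summit.BirchSwinnertonDyer.BirchSwinnertonDyer.Theorems.AddKatoTwo

open WeierstrassCurve Field Polynomial IsDedekindDomain NumberField IntermediateField Literature.NumberTheory.EllipticCurves
  Literature.NumberTheory.EllipticCurves.ZpExtension
  Literature.NumberTheory.GaloisRepresentations Literature.NumberTheory.IwasawaTheory Literature.NumberTheory.NumberFields
  Literature.Geometry.Kaehler.ComplexTorus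
  Summit.BirchSwinnertonDyer.BirchSwinnertonDyer.Theorems.AlignedTransportAtTwoTorsionPointField
  Summit.BirchSwinnertonDyer.BirchSwinnertonDyer.Theorems.SteinbergFibreAtTwo.NarrowRankCert

/-! ## §6 Assembly helpers: sign bits of scaled units and the two `#(U⁺/U²) = 2` certificates -/

section Scaled

variable {K : Type} [Field K]

/-- **Sign bit of a unit from a SCALED value, negative case**: if `d·e = v` in `K` (`0 < d`), then `sign(e)(σ) = 1` as soon as `σ v < 0`.
(The units of `A = ℚ(θ, √2)` are certified as `(a + c√2)/d`.) [cite: FrohlichTaylor1990, Ch. V §1 (1.10), p. 163] -/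
theorem signVec_eq_one_of_scaled_neg (σ : K →+* ℝ) (e : (𝓞 K)ˣ) {d : ℕ} (hd : 0 < d) {v : K}
    (he : (d : K) * ((e : 𝓞 K) : K) = v) (hneg : σ v < 0) : signVec e σ = 1 := by
  rw [signVec_apply, if_pos]
  have h := hneg
  rw [← he, map_mul, map_natCast] at h
  by_contra hle
  push Not at hle
  have : (0 : ℝ) ≤ (d : ℝ) * σ ((e : 𝓞 K) : K) := mul_nonneg (by exact_mod_cast hd.le) hle
  linarith

/-- **Sign bit of a unit from a SCALED value, positive case**: `d·e = v`, `0 < σ v` ⟹ `sign(e)(σ) = 0`.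
[cite: FrohlichTaylor1990, Ch. V §1 (1.10), p. 163] -/
theorem signVec_eq_zero_of_scaled_pos (σ : K →+* ℝ) (e : (𝓞 K)ˣ) {d : ℕ} (hd : 0 < d) {v : K}
    (he : (d : K) * ((e : 𝓞 K) : K) = v) (hpos : 0 < σ v) : signVec e σ = 0 := by
  rw [signVec_apply, if_neg]
  rw [← he, map_mul, map_natCast] at hpos
  push Not
  by_contra hlt
  push Not at hlt
  have : (d : ℝ) * σ ((e : 𝓞 K) : K) < 0 := mul_neg_of_pos_of_neg (by exact_mod_cast hd) hlt
  linarith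

/-- `0 < σ e` from a scaled value: `d·e = v`, `0 < σ v`, `0 < d`. [folklore] -/
theorem embedding_pos_of_scaled_pos (σ : K →+* ℝ) (e : (𝓞 K)ˣ) {d : ℕ} (hd : 0 < d) {v : K}
    (he : (d : K) * ((e : 𝓞 K) : K) = v) (hpos : 0 < σ v) : 0 < σ ((e : 𝓞 K) : K) := by
  rw [← he, map_mul, map_natCast] at hpos
  have hd' : (0 : ℝ) < d := by exact_mod_cast hd
  by_contra hle
  push Not at hle
  nlinarith

end Scaled

section Assembly

variable {K : Type} [Field K] [NumberField K]

/-- **`#(U⁺/U²)(K) = 2` for a totally real CUBIC field from: two distinct real embeddings `ρ₀, ρ₁`, a unit `ε` positive at `ρ₀`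
and negative at `ρ₁` (so `−1, ε` have independent signs: `#sign(U) ≥ 4`), and a totally positive unit `u` that is not a unit square
(`#(U⁺/U²) ≥ 2`).** [cite: FrohlichTaylor1990, Ch. V §1 (1.12)–(1.13), p. 164] -/
theorem card_totPosUnitsModSq_eq_two_of_cubic_certificate [IsTotallyReal K] (h3 : Module.finrank ℚ K = 3)
    (ρ₀ ρ₁ : K →+* ℝ) (ε : (𝓞 K)ˣ) (h0 : 0 < ρ₀ ((ε : 𝓞 K) : K)) (h1 : ρ₁ ((ε : 𝓞 K) : K) < 0)
    (u : (𝓞 K)ˣ) (hpos : ∀ σ : K →+* ℝ, 0 < σ ((u : 𝓞 K) : K)) (hns : ¬ ∃ w : (𝓞 K)ˣ, u = w ^ 2) :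
    Nat.card (TotPosUnitsModSq K) = 2 := by
  have hs : ∀ i j, signVec (![-1, ε] i) (![ρ₀, ρ₁] j) = !![(1 : ZMod 2), 1; 0, 1] i j := by
    intro i j
    fin_cases i <;> fin_cases j
    · show signVec (-1) ρ₀ = 1; rw [signVec_neg_one]
    · show signVec (-1) ρ₁ = 1; rw [signVec_neg_one]
    · show signVec ε ρ₀ = 0; rw [signVec_apply, if_neg (not_lt.mpr h0.le)]
    · show signVec ε ρ₁ = 1; rw [signVec_apply, if_pos h1]
  have hdet : IsUnit (!![(1 : ZMod 2), 1; 0, 1]) := by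
    haveI := invertibleOfRightInverse !![(1 : ZMod 2), 1; 0, 1] !![(1 : ZMod 2), 1; 0, 1] (by decide)
    exact isUnit_of_invertible _
  have hsig := two_pow_le_card_range_signVec ![-1, ε] ![ρ₀, ρ₁] _ hs hdet
  have htwo := two_le_card_totPosUnitsModSq_of_not_sq u hpos hns
  exact card_totPosUnitsModSq_eq_two_of_bounds (n := 2) h3 hsig htwo

end Assembly

section AssemblyLayer

variable {p q r : ℤ} {θ : AlgebraicClosure ℚ}

set_option maxHeartbeats 400000 in
/-- **`#(U⁺/U²)(A) = 2` for `A = ℚ(θ) ⊔ ℚ_1` from a `5 × 5` SIGN MATRIX and a non-square totally positive unit of `ℚ(θ)`**: `ℚ(θ)` a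
totally real cubic field, five units of `𝓞 A` whose sign matrix at five real embeddings is invertible over `𝔽₂` (`#sign(U_A) ≥ 2⁵`), and
a totally positive unit `u` of `𝓞 ℚ(θ)` that is not a unit square in `ℚ(θ)` (hence not in `A`, §2; it stays totally positive in `A`).
k4-w1's `card_totPosUnitsModSq_adjoin_sup_layer_one_d63644`, assembly part, with the cubic freed.
[cite: FrohlichTaylor1990, Ch. V §1 (1.12)–(1.13), p. 164] [cite: Washington1997, §13.1] -/
theorem card_totPosUnitsModSq_sup_layer_one_of_signMatrix (hirr : Irreducible (Cubic.toPoly ⟨1, (p : ℚ), q, r⟩))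
    (hθ : aeval θ (Cubic.toPoly ⟨1, (p : ℚ), q, r⟩) = 0)
    (hreal : haveI : FiniteDimensional ℚ ↥ℚ⟮θ⟯ :=
        IntermediateField.adjoin.finiteDimensional ⟨_, Cubic.monic_of_a_eq_one', by rwa [← aeval_def]⟩
      haveI : NumberField ↥ℚ⟮θ⟯ := NumberField.mk
      IsTotallyReal ↥ℚ⟮θ⟯)
    (u : haveI : FiniteDimensional ℚ ↥ℚ⟮θ⟯ :=
        IntermediateField.adjoin.finiteDimensional ⟨_, Cubic.monic_of_a_eq_one', by rwa [← aeval_def]⟩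
      haveI : FiniteDimensional ℚ ↥((CyclotomicZp.zpExtension 2).layer 1) :=
        (CyclotomicZp.zpExtension 2).finiteDimensional_layer_holds 1
      Fin 5 → (𝓞 ↥(ℚ⟮θ⟯ ⊔ (CyclotomicZp.zpExtension 2).layer 1))ˣ)
    (σ : Fin 5 → (↥(ℚ⟮θ⟯ ⊔ (CyclotomicZp.zpExtension 2).layer 1) →+* ℝ))
    (M : Matrix (Fin 5) (Fin 5) (ZMod 2)) (hM : ∀ i j, signVec (u i) (σ j) = M i j) (hdet : IsUnit M)
    (uE : haveI : FiniteDimensional ℚ ↥ℚ⟮θ⟯ :=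
        IntermediateField.adjoin.finiteDimensional ⟨_, Cubic.monic_of_a_eq_one', by rwa [← aeval_def]⟩
      (𝓞 ↥ℚ⟮θ⟯)ˣ)
    (hpos : ∀ φ : ↥ℚ⟮θ⟯ →+* ℝ, 0 < φ ((uE : 𝓞 ↥ℚ⟮θ⟯) : ↥ℚ⟮θ⟯)) (hns : ¬ ∃ w : (𝓞 ↥ℚ⟮θ⟯)ˣ, uE = w ^ 2) :
    haveI : FiniteDimensional ℚ ↥ℚ⟮θ⟯ :=
      IntermediateField.adjoin.finiteDimensional ⟨_, Cubic.monic_of_a_eq_one', by rwa [← aeval_def]⟩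
    haveI : FiniteDimensional ℚ ↥((CyclotomicZp.zpExtension 2).layer 1) := (CyclotomicZp.zpExtension 2).finiteDimensional_layer_holds 1
    haveI : NumberField ↥(ℚ⟮θ⟯ ⊔ (CyclotomicZp.zpExtension 2).layer 1) := NumberField.mk
    Nat.card (TotPosUnitsModSq ↥(ℚ⟮θ⟯ ⊔ (CyclotomicZp.zpExtension 2).layer 1)) = 2 := by
  haveI : FiniteDimensional ℚ ↥ℚ⟮θ⟯ :=
    IntermediateField.adjoin.finiteDimensional ⟨_, Cubic.monic_of_a_eq_one', by rwa [← aeval_def]⟩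
  haveI : FiniteDimensional ℚ ↥((CyclotomicZp.zpExtension 2).layer 1) := (CyclotomicZp.zpExtension 2).finiteDimensional_layer_holds 1
  haveI : NumberField ↥ℚ⟮θ⟯ := NumberField.mk
  haveI : NumberField ↥(ℚ⟮θ⟯ ⊔ (CyclotomicZp.zpExtension 2).layer 1) := NumberField.mk
  obtain ⟨hrealA, hfinA, h3⟩ := layer_one_basics hirr hθ hreal
  haveI := hrealA
  obtain ⟨t, ht, ht2⟩ := CyclotomicZp.exists_mem_layer_one_sq_eq_two_zpExtension
  have hKA : ℚ⟮θ⟯ ≤ ℚ⟮θ⟯ ⊔ (CyclotomicZp.zpExtension 2).layer 1 := le_sup_left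
  have hsig := two_pow_le_card_range_signVec u σ M hM hdet
  letI : Algebra ↥ℚ⟮θ⟯ ↥(ℚ⟮θ⟯ ⊔ (CyclotomicZp.zpExtension 2).layer 1) := (inclusion hKA).toRingHom.toAlgebra
  have halg : ∀ c : ↥ℚ⟮θ⟯, algebraMap ↥ℚ⟮θ⟯ ↥(ℚ⟮θ⟯ ⊔ (CyclotomicZp.zpExtension 2).layer 1) c = inclusion hKA c := fun _ => rfl
  haveI : IsScalarTower ℚ ↥ℚ⟮θ⟯ ↥(ℚ⟮θ⟯ ⊔ (CyclotomicZp.zpExtension 2).layer 1) := IsScalarTower.of_algebraMap_eq fun q => ((inclusion hKA).commutes q).symm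
  -- the totally positive non-square `u`, mapped to `A`
  set eU : (𝓞 ↥(ℚ⟮θ⟯ ⊔ (CyclotomicZp.zpExtension 2).layer 1))ˣ :=
    Units.map (algebraMap (𝓞 ↥ℚ⟮θ⟯) (𝓞 ↥(ℚ⟮θ⟯ ⊔ (CyclotomicZp.zpExtension 2).layer 1)) : 𝓞 ↥ℚ⟮θ⟯ →* 𝓞 ↥(ℚ⟮θ⟯ ⊔ (CyclotomicZp.zpExtension 2).layer 1)) uE with heUdef
  have heUval' : ((eU : 𝓞 ↥(ℚ⟮θ⟯ ⊔ (CyclotomicZp.zpExtension 2).layer 1)) : ↥(ℚ⟮θ⟯ ⊔ (CyclotomicZp.zpExtension 2).layer 1)) = inclusion hKA ((uE : 𝓞 ↥ℚ⟮θ⟯) : ↥ℚ⟮θ⟯) := by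
    rw [heUdef, Units.coe_map, MonoidHom.coe_coe, NumberField.RingOfIntegers.coe_eq_algebraMap, ← IsScalarTower.algebraMap_apply,
      IsScalarTower.algebraMap_apply (𝓞 ↥ℚ⟮θ⟯) ↥ℚ⟮θ⟯ ↥(ℚ⟮θ⟯ ⊔ (CyclotomicZp.zpExtension 2).layer 1), halg,
      NumberField.RingOfIntegers.coe_eq_algebraMap]
  have hposA : ∀ τ : ↥(ℚ⟮θ⟯ ⊔ (CyclotomicZp.zpExtension 2).layer 1) →+* ℝ, 0 < τ ((eU : 𝓞 ↥(ℚ⟮θ⟯ ⊔ (CyclotomicZp.zpExtension 2).layer 1)) : ↥(ℚ⟮θ⟯ ⊔ (CyclotomicZp.zpExtension 2).layer 1)) := fun τ => by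
    rw [heUval', show τ (inclusion hKA ((uE : 𝓞 ↥ℚ⟮θ⟯) : ↥ℚ⟮θ⟯)) =
      (τ.comp (inclusion hKA).toRingHom) ((uE : 𝓞 ↥ℚ⟮θ⟯) : ↥ℚ⟮θ⟯) from rfl]
    exact hpos _
  have hnsA := not_exists_sq_eq_map_of_not_exists_sq hirr hθ hreal ht ht2 uE hns eU heUval'
  have htwo := two_le_card_totPosUnitsModSq_of_not_sq eU hposA hnsA
  exact card_totPosUnitsModSq_eq_two_of_bounds (n := 5) hfinA hsig htwo

/-- **The two narrow indices are EQUAL (both `= 2`)** for a totally real cubic `ℚ(θ)` and `A = ℚ(θ) ⊔ ℚ_1` from: `h(ℚ(θ))` odd, the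
one-bit currency for `h(A)` (§3), and `#(U⁺/U²) = 2` at both layers — the hypothesis `hr` of the narrow-Fukuda door.
[cite: FrohlichTaylor1990, Ch. V §1 (1.8)–(1.13), pp. 163–164] [cite: Fukuda1994, Thm. 1 (2), p. 264] -/
theorem narrowIndex_sup_layer_one_eq_of_cards (hirr : Irreducible (Cubic.toPoly ⟨1, (p : ℚ), q, r⟩))
    (hθ : aeval θ (Cubic.toPoly ⟨1, (p : ℚ), q, r⟩) = 0)
    (hreal : haveI : FiniteDimensional ℚ ↥ℚ⟮θ⟯ :=
        IntermediateField.adjoin.finiteDimensional ⟨_, Cubic.monic_of_a_eq_one', by rwa [← aeval_def]⟩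
      haveI : NumberField ↥ℚ⟮θ⟯ := NumberField.mk
      IsTotallyReal ↥ℚ⟮θ⟯)
    (hK : haveI : FiniteDimensional ℚ ↥ℚ⟮θ⟯ :=
        IntermediateField.adjoin.finiteDimensional ⟨_, Cubic.monic_of_a_eq_one', by rwa [← aeval_def]⟩
      haveI : NumberField ↥ℚ⟮θ⟯ := NumberField.mk
      Odd (classNumber ↥ℚ⟮θ⟯))
    (h1 : haveI : FiniteDimensional ℚ (IntermediateField.adjoin ℚ {θ}) :=
        IntermediateField.adjoin.finiteDimensional ((AlgebraicClosure.isAlgebraic ℚ).isAlgebraic θ).isIntegral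
      haveI : NumberField (IntermediateField.adjoin ℚ {θ}) := NumberField.mk
      ∀ κL : ZpExtension (IntermediateField.adjoin ℚ {θ}) 2, κL.IsCyclotomic → classNumberPExp κL 1 = 0)
    (hcardK : haveI : FiniteDimensional ℚ ↥ℚ⟮θ⟯ :=
        IntermediateField.adjoin.finiteDimensional ⟨_, Cubic.monic_of_a_eq_one', by rwa [← aeval_def]⟩
      haveI : NumberField ↥ℚ⟮θ⟯ := NumberField.mk
      Nat.card (TotPosUnitsModSq ↥ℚ⟮θ⟯) = 2)
    (hcardA : haveI : FiniteDimensional ℚ ↥ℚ⟮θ⟯ :=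
        IntermediateField.adjoin.finiteDimensional ⟨_, Cubic.monic_of_a_eq_one', by rwa [← aeval_def]⟩
      haveI : FiniteDimensional ℚ ↥((CyclotomicZp.zpExtension 2).layer 1) := (CyclotomicZp.zpExtension 2).finiteDimensional_layer_holds 1
      haveI : NumberField ↥(ℚ⟮θ⟯ ⊔ (CyclotomicZp.zpExtension 2).layer 1) := NumberField.mk
      Nat.card (TotPosUnitsModSq ↥(ℚ⟮θ⟯ ⊔ (CyclotomicZp.zpExtension 2).layer 1)) = 2) :
    haveI : FiniteDimensional ℚ ↥ℚ⟮θ⟯ :=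
      IntermediateField.adjoin.finiteDimensional ⟨_, Cubic.monic_of_a_eq_one', by rwa [← aeval_def]⟩
    haveI : FiniteDimensional ℚ ↥((CyclotomicZp.zpExtension 2).layer 1) := (CyclotomicZp.zpExtension 2).finiteDimensional_layer_holds 1
    haveI : NumberField ↥ℚ⟮θ⟯ := NumberField.mk
    haveI : NumberField ↥(ℚ⟮θ⟯ ⊔ (CyclotomicZp.zpExtension 2).layer 1) := NumberField.mk
    (powMonoidHom (α := NarrowClassGroup ↥(ℚ⟮θ⟯ ⊔ (CyclotomicZp.zpExtension 2).layer 1)) 2).range.index =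
      (powMonoidHom (α := NarrowClassGroup ↥ℚ⟮θ⟯) 2).range.index := by
  haveI : FiniteDimensional ℚ ↥ℚ⟮θ⟯ :=
    IntermediateField.adjoin.finiteDimensional ⟨_, Cubic.monic_of_a_eq_one', by rwa [← aeval_def]⟩
  haveI : FiniteDimensional ℚ ↥((CyclotomicZp.zpExtension 2).layer 1) := (CyclotomicZp.zpExtension 2).finiteDimensional_layer_holds 1
  haveI : NumberField ↥ℚ⟮θ⟯ := NumberField.mk
  haveI : NumberField ↥(ℚ⟮θ⟯ ⊔ (CyclotomicZp.zpExtension 2).layer 1) := NumberField.mk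
  obtain ⟨hrealA, -, -⟩ := layer_one_basics hirr hθ hreal
  haveI := hrealA
  haveI : IsTotallyReal ↥ℚ⟮θ⟯ := hreal
  rw [index_range_pow_two_narrowClassGroup_eq_card_totPosUnitsModSq_of_odd_classNumber
      (odd_classNumber_sup_layer_one_of_layerOneBit hirr hθ h1),
    index_range_pow_two_narrowClassGroup_eq_card_totPosUnitsModSq_of_odd_classNumber hK, hcardA, hcardK]

end AssemblyLayer

/-! ## §5 The door in census currency: (A)₂ for a cubic model from the narrow road of its `2`-torsion field -/

section Door

variable {p q r : ℤ} {θ : AlgebraicClosure ℚ}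

set_option maxHeartbeats 800000 in
/-- **(A)₂ for `y² = x³ + Px² + Qx + R` from the NARROW ROAD of its (totally real) `2`-torsion field** — k4-w1's `conjA_two_445508b1''`
with the curve and the field freed: `β` a root of the curve's cubic, `ℚ(β) = ℚ(θ)` for a root `θ` of an irreducible integer cubic
`X³ + pX² + qX + r` with `ℚ(θ)` TOTALLY REAL, Fukuda's index `0` for every cyclotomic `ℤ₂`-extension of `ℚ(θ)`, and the narrow rank
equality `[Cl⁺(ℚ(θ) ⊔ ℚ_1) : (Cl⁺)²] = [Cl⁺(ℚ(θ)) : (Cl⁺)²]` ⟹ for every cyclotomic `ℤ₂`-extension of `ℚ` the dual fine Selmer group of the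
curve over `ℚ_∞` is finitely generated over `ℤ₂` (`∃ γ D` currency; w2's `conjA_two_of_narrowRank_sqrtTwo_model_pointField` through
k4-w1's `conjA_two_of_pointField_of_narrowRank_sqrtTwo_model`). Statement (A) only — NOT BSD for the curve.
[cite: CoatesSujatha2005, Conj. A and Thm. 3.4] [cite: Fukuda1994, Thm. 1 (2), p. 264] [cite: FrohlichTaylor1990, Ch. V §1 (1.12)–(1.13)] -/
theorem conjA_two_cubicModel_of_narrowRoad (P Q R : ℤ)
    [((⟨0, (P : ℚ), 0, (Q : ℚ), (R : ℚ)⟩ : WeierstrassCurve ℚ)).IsElliptic]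
    {β : AlgebraicClosure ℚ} (hβ : aeval β (Cubic.toPoly ⟨1, (P : ℚ), Q, R⟩) = 0)
    (hirr : Irreducible (Cubic.toPoly ⟨1, (p : ℚ), q, r⟩)) (hθ : aeval θ (Cubic.toPoly ⟨1, (p : ℚ), q, r⟩) = 0)
    (hadj : IntermediateField.adjoin ℚ {θ} = IntermediateField.adjoin ℚ {β})
    (hreal : haveI : FiniteDimensional ℚ ↥ℚ⟮θ⟯ :=
        IntermediateField.adjoin.finiteDimensional ⟨_, Cubic.monic_of_a_eq_one', by rwa [← aeval_def]⟩
      haveI : NumberField ↥ℚ⟮θ⟯ := NumberField.mk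
      IsTotallyReal ↥ℚ⟮θ⟯)
    (h0 : haveI : FiniteDimensional ℚ ↥ℚ⟮θ⟯ :=
        IntermediateField.adjoin.finiteDimensional ⟨_, Cubic.monic_of_a_eq_one', by rwa [← aeval_def]⟩
      haveI : NumberField ↥ℚ⟮θ⟯ := NumberField.mk
      ∀ κP : ZpExtension ↥ℚ⟮θ⟯ 2, κP.IsCyclotomic → TotallyRamifiedFrom κP 0)
    (hr : haveI : FiniteDimensional ℚ ↥ℚ⟮θ⟯ :=
        IntermediateField.adjoin.finiteDimensional ⟨_, Cubic.monic_of_a_eq_one', by rwa [← aeval_def]⟩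
      haveI : FiniteDimensional ℚ ↥((CyclotomicZp.zpExtension 2).layer 1) := (CyclotomicZp.zpExtension 2).finiteDimensional_layer_holds 1
      haveI : NumberField ↥ℚ⟮θ⟯ := NumberField.mk
      haveI : NumberField ↥(ℚ⟮θ⟯ ⊔ (CyclotomicZp.zpExtension 2).layer 1) := NumberField.mk
      (powMonoidHom (α := NarrowClassGroup ↥(ℚ⟮θ⟯ ⊔ (CyclotomicZp.zpExtension 2).layer 1)) 2).range.index =
        (powMonoidHom (α := NarrowClassGroup ↥ℚ⟮θ⟯) 2).range.index)
    (κ : ZpExtension ℚ 2) (hκ : κ.IsCyclotomic) :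
    ∃ (γ : absoluteGaloisGroup ℚ) (D : ((⟨0, (P : ℚ), 0, (Q : ℚ), (R : ℚ)⟩ : WeierstrassCurve ℚ)).FineSelmerDualData κ γ),
      Module.Finite ℤ_[2] (RestrictScalars ℤ_[2] (IwasawaAlgebra 2) D.X) := by
  obtain ⟨P₀, hP₀, hP₀eq⟩ := exists_geomTorsion_two_eq_some_root (P : ℚ) (Q : ℚ) (R : ℚ) hβ
  have hF : IntermediateField.fixedField (MulAction.stabilizer (absoluteGaloisGroup ℚ) P₀) =
      IntermediateField.adjoin ℚ {θ} := by
    rw [fixedField_stabilizer_eq_adjoin_root _ _ _ hβ hP₀eq, hadj]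
    -- the two `Algebra ℚ ℚ̄` instance paths agree
    congr 1
  have hfm : (Cubic.toPoly ⟨1, (p : ℚ), q, r⟩).Monic := Cubic.monic_of_a_eq_one'
  have hθint : IsIntegral ℚ θ := ⟨_, hfm, by rwa [← aeval_def]⟩
  haveI : FiniteDimensional ℚ ↥ℚ⟮θ⟯ := IntermediateField.adjoin.finiteDimensional hθint
  haveI : FiniteDimensional ℚ ↥((CyclotomicZp.zpExtension 2).layer 1) := (CyclotomicZp.zpExtension 2).finiteDimensional_layer_holds 1
  haveI : NumberField ↥ℚ⟮θ⟯ := NumberField.mk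
  haveI : NumberField ↥(ℚ⟮θ⟯ ⊔ (CyclotomicZp.zpExtension 2).layer 1) := NumberField.mk
  obtain ⟨-, hfinA, h3⟩ := layer_one_basics hirr hθ hreal
  have hodd : Odd (Module.finrank ℚ ↥ℚ⟮θ⟯) := by rw [h3]; decide
  -- the model `A = ℚ(θ) ⊔ ℚ_1` of `ℚ(θ)(√2)`
  obtain ⟨t, ht, ht2⟩ := CyclotomicZp.exists_mem_layer_one_sq_eq_two_zpExtension
  have hKA : ℚ⟮θ⟯ ≤ ℚ⟮θ⟯ ⊔ (CyclotomicZp.zpExtension 2).layer 1 := le_sup_left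
  have htA : t ∈ ℚ⟮θ⟯ ⊔ (CyclotomicZp.zpExtension 2).layer 1 := (le_sup_right : (CyclotomicZp.zpExtension 2).layer 1 ≤ _) ht
  have ht'2 : (⟨t, htA⟩ : ↥(ℚ⟮θ⟯ ⊔ (CyclotomicZp.zpExtension 2).layer 1)) ^ 2 = 2 := by
    apply (algebraMap ↥(ℚ⟮θ⟯ ⊔ (CyclotomicZp.zpExtension 2).layer 1) (AlgebraicClosure ℚ)).injective
    rw [map_pow, map_ofNat]
    exact ht2
  letI : Algebra ↥ℚ⟮θ⟯ ↥(ℚ⟮θ⟯ ⊔ (CyclotomicZp.zpExtension 2).layer 1) := (IntermediateField.inclusion hKA).toRingHom.toAlgebra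
  haveI : IsScalarTower ℚ ↥ℚ⟮θ⟯ ↥(ℚ⟮θ⟯ ⊔ (CyclotomicZp.zpExtension 2).layer 1) := IsScalarTower.of_algebraMap_eq fun q => ((IntermediateField.inclusion hKA).commutes q).symm
  haveI : Module.Finite ↥ℚ⟮θ⟯ ↥(ℚ⟮θ⟯ ⊔ (CyclotomicZp.zpExtension 2).layer 1) := Module.Finite.of_restrictScalars_finite ℚ ↥ℚ⟮θ⟯ _
  have hdeg : Module.finrank ↥ℚ⟮θ⟯ ↥(ℚ⟮θ⟯ ⊔ (CyclotomicZp.zpExtension 2).layer 1) = 2 := by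
    have htower := Module.finrank_mul_finrank ℚ ↥ℚ⟮θ⟯ ↥(ℚ⟮θ⟯ ⊔ (CyclotomicZp.zpExtension 2).layer 1)
    rw [h3, hfinA] at htower
    omega
  exact conjA_two_of_pointField_of_narrowRank_sqrtTwo_model _ hP₀ ℚ⟮θ⟯ hF hodd h0
    ↥(ℚ⟮θ⟯ ⊔ (CyclotomicZp.zpExtension 2).layer 1) hdeg ⟨t, htA⟩ ht'2 hr κ hκ

end Door

end Summit.BirchSwinnertonDyer.BirchSwinnertonDyer.Theorems.AddKatoTwo

end
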